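import Literature.NumberTheory.Rogawski1990.UnitaryThreeUnipotentStrataCM          -- ★ p849223 (LH4-p01): the `T = 1` frame idioms `isConj_iff_exists_conj_localNonsplitEquiv`, `sub_one_pow_eq_zero_iff_conj_localNonsplitEquiv`, `conj_localNonsplitEquiv_eq_one_iff`, `placeForm_antidiagOne_eq_formCongr_one`
import Literature.NumberTheory.Automorphic.UnitaryThreeUnipotentConjugacy             -- ★ `exists_conj_coe_eq_cornerUnipotent_of_sq_eq_zero` (the corner normal form `n(t)`, any field with involution)
import Literature.MeasureTheory.Group.OrbitalFinitenessTransport                     -- ★ p849303 (this seat): `measure_preimage_descConj_lt_top_of_isConj`, `integrable_descConj_of_isConj_of_forall_measure_preimage_lt_top` (Rao finiteness transports along `IsConj`)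
import Literature.NumberTheory.Rogawski1990.UnipotentOrbitalIntegralConvergenceTransvectionCM   -- ★ p849314 (F0P3a-p09 (g4)): `UnitaryGroup.measure_preimage_descConj_lt_top_of_coe_eq_cornerUnipotent` (Rao finiteness AT the corner base point)
import Literature.NumberTheory.Rogawski1990.LocalTransferFundamentalLemma             -- ★ `IsLocSmooth`
import HarnessLib

/-!
# RANGA RAO AT THE SINGULAR (TRANSVECTION) UNIPOTENT CLASSES OF `U(Φ₃)(L⁺_v)`: every transvection has a corner base point `ψ(γ₀) = n(t₀)` in its class, and the
# Rao clause for the whole class follows from the base-point finiteness ★ p849314 (Rogawski 1990 §3.9 p. 32, §4.9 p. 54, §8.1 p. 112; Rao 1972)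

Topic `NumberTheory/Rogawski1990`; namespace `Literature.NumberTheory.Rogawski1990`.  THEOREMS ONLY (no definition, no instance, no notation, no named fact, no `sorry`).
Cell `pub/hodgecm-mathlib`, crux H413 (`stmt-HodgeConjecture-24833`), line LH4 «Shalika germs», organ ‹RAO› (the Ranga-Rao clause of `stub_ShRao`, road (α′) of the census memo
`RAO-CONV.census.F0P3ap09g4.md` 476bb72b), sub-head (C′) «SINGULAR CASE-HEAD ASSEMBLY» (LH4-plan (g2) DEALER WORDS #24 (c) ∕ #28 (a) ∕ #31; LH10-p01 (g2); sibling of ★ p849314, one writer per file).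

WHAT.  `G = (cmDatum L 3 Φ₃).Local v = U(Φ₃)(L⁺_v)` at a non-split `v` (one place `w ∣ v`), read through the one-place model `ψ = localNonsplitEquiv` at the trivial frame `T = 1`
(★ `placeForm_antidiagOne_eq_formCongr_one`: `ψ : G ≃ U(σ_w, J₀)(L_w)`).  A TRANSVECTION of `G` is a `γ ≠ 1` with `(γ − 1)² = 0` (in `GL₃(L ⊗ L⁺_v)`).
* §1 **`exists_isConj_conj_localNonsplitEquiv_eq_cornerUnipotent`** — «WHICH CLASS»: every transvection `γ` is conjugate IN `G` to a `γ₀` with `ψ(γ₀) = n(t₀) = 1 + t₀E₀₂`,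
  `σ_w t₀ + t₀ = 0`, `t₀ ≠ 0` (★ `exists_conj_coe_eq_cornerUnipotent_of_sq_eq_zero` in `U(σ_w, J₀)`, pulled back through `ψ`: ★ `sub_one_pow_eq_zero_iff_conj_localNonsplitEquiv`,
  ★ `exists_conj_localNonsplitEquiv_eq`, ★ `isConj_iff_exists_conj_localNonsplitEquiv`, ★ `conj_localNonsplitEquiv_eq_one_iff`).
* §2 **`UnitaryGroup.measure_preimage_descConj_lt_top_of_transvection`** and THE CASE HEAD OF RECORD **`UnitaryGroup.integrable_descConj_of_isLocSmooth_of_transvection`**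
  (LH4-plan (g2) DEALER WORDS #25 (a) ∕ #31 ∕ #35 (r3): HCONV prefix `(L)(v)(w)(hsub)[4 inst](γ)`, then `(hsing)(hγ1)(μ)[inv][fin](f)(hf)`, ∀-closed, the idle `h2` and `(γ−1)³ = 0`
  DROPPED — ★ p849278's three-way split `…_of_unipotent_of_cases` feeds it through a one-line lambda): at EVERY transvection `γ` of `G`, every `G`-invariant measure on `G ⧸ C(γ)` finite
  on compacta gives finite mass to `{yC(γ) ∣ y γ y⁻¹ ∈ C}` (`C` compact), hence `y C(γ) ↦ f(y γ y⁻¹)` is integrable for every `f ∈ C_c^∞(G)`.  Proof: §1 «which class» ⇒ a corner base point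
  `γ₀ ∼ γ`; ★ p849314 `UnitaryGroup.measure_preimage_descConj_lt_top_of_coe_eq_cornerUnipotent` (F0P3a-p09 (g4): Iwasawa covering + ★ p849197 finiteness along the contracting
  torus element) gives the μ-GENERIC finiteness at `γ₀`; ★ p849303 `measure_preimage_descConj_lt_top_of_isConj` ∕ `integrable_descConj_of_isConj_of_forall_measure_preimage_lt_top`
  transports it along `IsConj γ₀ γ` (no uniqueness scalar: the statement quantifies over all invariant Radon `μ`).
HONEST LABEL: HC_CM is proved only modulo the 7 printed citations (2 remaining: hLiu418 = stmt-HodgeConjecture-24832, h413 = stmt-HodgeConjecture-24833) until rung 0 closes;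
count-neutral ★ bricks `--supports stmt-HodgeConjecture-24833`.

## References
* [Rogawski1990] J. Rogawski, *Automorphic Representations of Unitary Groups in Three Variables* (1990), §3.9 p. 32 (unipotent classes, `G_u = S·N`), §4.9 p. 54, §8.1 p. 112.
* [Rao1972] R. Ranga Rao, *Orbital integrals in reductive groups*, Ann. of Math. (2) 96 (1972) 505–510.
-/

set_option autoImplicit false

noncomputable section

open scoped WithZero Matrix MatrixGroups ValuativeRel
open MeasureTheory Topology Set NumberField IsDedekindDomain Matrix

namespace Literature.NumberTheory.Rogawski1990

open Literature.NumberTheory.Automorphic Literature.NumberTheory.Automorphic.UnitaryGroup Literature.NumberTheory.GaloisRepresentations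
open Literature.MeasureTheory.Group

/-! ## §1 Every transvection is conjugate to a corner base point `ψ(γ₀) = n(t₀)` -/

section WhichClass

variable (L : Type) [Field L] [NumberField L] [IsCMField L] {v : HeightOneSpectrum (𝓞 ↥(maximalRealSubfield L))} (w : UnitaryGroup.PlacesOver L v)
  (hw : IsCMField.complexConj L • w.1 = w.1)

set_option maxHeartbeats 400000 in
-- long coercion towers through `ψ`
/-- **WHICH CLASS — every transvection of `U(Φ₃)(L⁺_v)` is conjugate to a corner base point.**  For `γ ∈ G` with `(γ − 1)² = 0`, `γ ≠ 1` (one place `w ∣ v`), there are `t₀ ∈ L_w`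
with `σ_w t₀ + t₀ = 0`, `t₀ ≠ 0`, and `γ₀ ∈ G` with `ψ(γ₀) = n(t₀) = 1 + t₀ E₀₂` and `γ₀ ∼ γ` IN `G`.  (★ `exists_conj_coe_eq_cornerUnipotent_of_sq_eq_zero` in `U(σ_w, J₀)(L_w)`,
pulled back through the bijection `ψ`.) [cite: Rogawski1990, §3.9 p. 32] -/
theorem exists_isConj_conj_localNonsplitEquiv_eq_cornerUnipotent (hsub : Subsingleton (UnitaryGroup.PlacesOver L v))
    (γ : (cmDatum L 3 (Matrix.of fun i j : Fin 3 => if i.val + j.val + 1 = 3 then (1 : L) else 0)).Local v)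
    (hsing : ((γ.val : GL (Fin 3) (UnitaryGroup.LocalRing L v)).val - 1) ^ 2 = 0) (hγ1 : γ ≠ 1) :
    ∃ (t₀ : w.1.adicCompletion L) (γ₀ : (cmDatum L 3 (Matrix.of fun i j : Fin 3 => if i.val + j.val + 1 = 3 then (1 : L) else 0)).Local v),
      galAdicCompletionMap (L := L) (IsCMField.complexConj L) hw t₀ + t₀ = 0 ∧ t₀ ≠ 0 ∧
      (((localNonsplitEquiv (IsCMField.complexConj L) (Matrix.of fun i j : Fin 3 => if i.val + j.val + 1 = 3 then (1 : L) else 0)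
          (IsCMField.complexConj_ne_one L) w hw γ₀ :
            ↥(unitaryGroupOfForm (galAdicCompletionMap (L := L) (IsCMField.complexConj L) hw)
              (placeForm (Matrix.of fun i j : Fin 3 => if i.val + j.val + 1 = 3 then (1 : L) else 0) w.1))) : GL (Fin 3) (w.1.adicCompletion L)) :
        Matrix (Fin 3) (Fin 3) (w.1.adicCompletion L)) = !![1, 0, t₀; 0, 1, 0; 0, 0, 1] ∧
      IsConj γ₀ γ := by
  have hσ : ∀ z : w.1.adicCompletion L, galAdicCompletionMap (L := L) (IsCMField.complexConj L) hw (galAdicCompletionMap (L := L) (IsCMField.complexConj L) hw z) = z :=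
    galAdicCompletionMap_involutive L v w hw
  have hT := placeForm_antidiagOne_eq_formCongr_one L w hw
  -- `ψ γ ∈ U(σ_w, J₀)` with `(ψγ − 1)² = 0`
  have hu := conj_localNonsplitEquiv_mem L (Matrix.of fun i j : Fin 3 => if i.val + j.val + 1 = 3 then (1 : L) else 0) v w hw hT γ
  have hsq2 := (sub_one_pow_eq_zero_iff_conj_localNonsplitEquiv L w hw hsub γ 2).1 hsing
  rw [pow_two] at hsq2
  obtain ⟨k, hk, t₀, ht₀, hkt⟩ := exists_conj_coe_eq_cornerUnipotent_of_sq_eq_zero (galAdicCompletionMap (L := L) (IsCMField.complexConj L) hw) hσ hu hsq2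
  -- pull `k ψγ k⁻¹` back through `ψ`
  obtain ⟨γ₀, hγ₀⟩ := exists_conj_localNonsplitEquiv_eq L (Matrix.of fun i j : Fin 3 => if i.val + j.val + 1 = 3 then (1 : L) else 0) v w hw hT
    (Subgroup.mul_mem _ (Subgroup.mul_mem _ hk hu) (Subgroup.inv_mem _ hk))
  have hconj : IsConj γ γ₀ := (isConj_iff_exists_conj_localNonsplitEquiv L w hw γ γ₀).2 ⟨k, hk, hγ₀.symm⟩
  have hbare : (((localNonsplitEquiv (IsCMField.complexConj L) (Matrix.of fun i j : Fin 3 => if i.val + j.val + 1 = 3 then (1 : L) else 0)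
          (IsCMField.complexConj_ne_one L) w hw γ₀ :
            ↥(unitaryGroupOfForm (galAdicCompletionMap (L := L) (IsCMField.complexConj L) hw)
              (placeForm (Matrix.of fun i j : Fin 3 => if i.val + j.val + 1 = 3 then (1 : L) else 0) w.1))) : GL (Fin 3) (w.1.adicCompletion L)) :
        Matrix (Fin 3) (Fin 3) (w.1.adicCompletion L)) = !![1, 0, t₀; 0, 1, 0; 0, 0, 1] := by
    rw [← hkt, ← hγ₀, one_mul, inv_one, mul_one]
  refine ⟨t₀, γ₀, ht₀, ?_, hbare, hconj.symm⟩
  -- `t₀ ≠ 0` since `γ ≠ 1`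
  rintro rfl
  apply hγ1
  have h1 : (((1 : GL (Fin 3) (w.1.adicCompletion L)) * ((localNonsplitEquiv (IsCMField.complexConj L) (Matrix.of fun i j : Fin 3 => if i.val + j.val + 1 = 3 then (1 : L) else 0)
          (IsCMField.complexConj_ne_one L) w hw γ₀ :
            ↥(unitaryGroupOfForm (galAdicCompletionMap (L := L) (IsCMField.complexConj L) hw)
              (placeForm (Matrix.of fun i j : Fin 3 => if i.val + j.val + 1 = 3 then (1 : L) else 0) w.1))) : GL (Fin 3) (w.1.adicCompletion L)) *
          (1 : GL (Fin 3) (w.1.adicCompletion L))⁻¹ : GL (Fin 3) (w.1.adicCompletion L)) : Matrix (Fin 3) (Fin 3) (w.1.adicCompletion L)) = 1 := by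
    rw [hγ₀, hkt, Matrix.one_fin_three]
  have hγ₀1 : γ₀ = 1 := (conj_localNonsplitEquiv_eq_one_iff L w hw γ₀).1 (Units.ext h1)
  rw [hγ₀1] at hconj
  exact (isConj_one_right.1 hconj.symm).symm ▸ rfl

end WhichClass

/-! ## §2 The case head `…_of_transvection` from the base-point finiteness -/

section CaseHead

set_option maxHeartbeats 400000 in
-- statement-heavy: four instance binders
/-- **RANGA RAO AT EVERY TRANSVECTION OF `U(Φ₃)(L⁺_v)` — FINITENESS OF ORBIT-PREIMAGES OF COMPACTA.**  At a non-split `v` (one place `w ∣ v`), for `γ ∈ G` with `(γ − 1)² = 0`,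
`γ ≠ 1`, EVERY `G`-invariant measure `μ` on `G ⧸ C(γ)` finite on compacta gives finite mass to `{yC(γ) ∣ y γ y⁻¹ ∈ C}` for every compact `C ⊆ G`: §1 gives a corner base point
`γ₀ ∼ γ`, ★ p849314 the finiteness at `γ₀` for ALL invariant Radon measures, ★ p849303 transports it along `IsConj γ₀ γ`.  (Binders: the place data `(hsub)` is used; no
oddness is needed for the singular classes.) [cite: Rao1972, Theorem] [cite: Rogawski1990, §3.9 p. 32; §4.9 p. 54; §8.1 p. 112] -/
theorem UnitaryGroup.measure_preimage_descConj_lt_top_of_transvection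
    (L : Type) [Field L] [NumberField L] [IsCMField L] (v : HeightOneSpectrum (𝓞 ↥(maximalRealSubfield L))) (w : UnitaryGroup.PlacesOver L v)
    (hsub : Subsingleton (UnitaryGroup.PlacesOver L v))
    [MeasurableSpace ((cmDatum L 3 (Matrix.of fun i j : Fin 3 => if i.val + j.val + 1 = 3 then (1 : L) else 0)).Local v)]
    [BorelSpace ((cmDatum L 3 (Matrix.of fun i j : Fin 3 => if i.val + j.val + 1 = 3 then (1 : L) else 0)).Local v)]
    [∀ γ : ((cmDatum L 3 (Matrix.of fun i j : Fin 3 => if i.val + j.val + 1 = 3 then (1 : L) else 0)).Local v),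
      MeasurableSpace (((cmDatum L 3 (Matrix.of fun i j : Fin 3 => if i.val + j.val + 1 = 3 then (1 : L) else 0)).Local v) ⧸
        Subgroup.centralizer ({γ} : Set ((cmDatum L 3 (Matrix.of fun i j : Fin 3 => if i.val + j.val + 1 = 3 then (1 : L) else 0)).Local v)))]
    [∀ γ : ((cmDatum L 3 (Matrix.of fun i j : Fin 3 => if i.val + j.val + 1 = 3 then (1 : L) else 0)).Local v),
      BorelSpace (((cmDatum L 3 (Matrix.of fun i j : Fin 3 => if i.val + j.val + 1 = 3 then (1 : L) else 0)).Local v) ⧸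
        Subgroup.centralizer ({γ} : Set ((cmDatum L 3 (Matrix.of fun i j : Fin 3 => if i.val + j.val + 1 = 3 then (1 : L) else 0)).Local v)))]
    (γ : (cmDatum L 3 (Matrix.of fun i j : Fin 3 => if i.val + j.val + 1 = 3 then (1 : L) else 0)).Local v)
    (hsing : ((γ.val : GL (Fin 3) (UnitaryGroup.LocalRing L v)).val - 1) ^ 2 = 0) (hγ1 : γ ≠ 1)
    (μ : Measure (((cmDatum L 3 (Matrix.of fun i j : Fin 3 => if i.val + j.val + 1 = 3 then (1 : L) else 0)).Local v) ⧸
      Subgroup.centralizer ({γ} : Set ((cmDatum L 3 (Matrix.of fun i j : Fin 3 => if i.val + j.val + 1 = 3 then (1 : L) else 0)).Local v))))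
    [SMulInvariantMeasure ((cmDatum L 3 (Matrix.of fun i j : Fin 3 => if i.val + j.val + 1 = 3 then (1 : L) else 0)).Local v) _ μ] [IsFiniteMeasureOnCompacts μ]
    {C : Set ((cmDatum L 3 (Matrix.of fun i j : Fin 3 => if i.val + j.val + 1 = 3 then (1 : L) else 0)).Local v)} (hC : IsCompact C) :
    μ ((descConj γ (Subgroup.centralizer ({γ} : Set ((cmDatum L 3 (Matrix.of fun i j : Fin 3 => if i.val + j.val + 1 = 3 then (1 : L) else 0)).Local v)))
      (fun _ hg => Subgroup.mem_centralizer_singleton_iff.1 hg) id) ⁻¹' C) < ⊤ := by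
  have hw : IsCMField.complexConj L • w.1 = w.1 := smul_placesOver_eq_of_subsingleton L v (IsCMField.complexConj L) hsub w
  obtain ⟨t₀, γ₀, -, ht₀0, hψ, hc⟩ := exists_isConj_conj_localNonsplitEquiv_eq_cornerUnipotent L w hw hsub γ hsing hγ1
  exact measure_preimage_descConj_lt_top_of_isConj
    (fun μ₀ _ _ C₀ hC₀ => UnitaryGroup.measure_preimage_descConj_lt_top_of_coe_eq_cornerUnipotent L v w hw γ₀ ht₀0 hψ μ₀ hC₀) hc μ hC

set_option maxHeartbeats 400000 in
-- statement-heavy: four instance binders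
/-- **THE SINGULAR CASE HEAD OF THE RANGA-RAO CLAUSE — `UnitaryGroup.integrable_descConj_of_isLocSmooth_of_transvection`** (text of record, LH4-plan (g2) DEALER WORDS #25 (a),
MINUS the two idle binders `IsUnit (2 : 𝒪[L_w])` and `(γ − 1)³ = 0` by ruling #35 (r3); ★ p849278's split feeds it through a one-line lambda).  HCONV prefix `(L)(v)(w)`,
`Subsingleton (PlacesOver L v) →`, the four σ-algebra binders, then `∀ γ, (γ − 1)² = 0 → γ ≠ 1 →` for every `G`-invariant `μ` on `G ⧸ C(γ)` finite on compacta and every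
`f ∈ C_c^∞(G)` (★ `IsLocSmooth`): the orbital integrand `y C(γ) ↦ f(y γ y⁻¹)` is `μ`-integrable.  Proof: `measure_preimage_descConj_lt_top_of_transvection` + ★ p849197
`integrable_descConj_of_measure_preimage_lt_top` (`f` continuous with compact support). [cite: Rao1972, Theorem] [cite: Rogawski1990, §4.9 p. 54; §8.1 p. 112]
[cite: HarishChandra1999AdmissibleDistributions, §3.1 p. 17] -/
theorem UnitaryGroup.integrable_descConj_of_isLocSmooth_of_transvection :
    ∀ (L : Type) [Field L] [NumberField L] [IsCMField L] (v : HeightOneSpectrum (𝓞 ↥(maximalRealSubfield L))) (w : UnitaryGroup.PlacesOver L v),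
      Subsingleton (UnitaryGroup.PlacesOver L v) →
      ∀ [MeasurableSpace ((cmDatum L 3 (Matrix.of fun i j : Fin 3 => if i.val + j.val + 1 = 3 then (1 : L) else 0)).Local v)]
        [BorelSpace ((cmDatum L 3 (Matrix.of fun i j : Fin 3 => if i.val + j.val + 1 = 3 then (1 : L) else 0)).Local v)]
        [∀ γ : ((cmDatum L 3 (Matrix.of fun i j : Fin 3 => if i.val + j.val + 1 = 3 then (1 : L) else 0)).Local v),
          MeasurableSpace (((cmDatum L 3 (Matrix.of fun i j : Fin 3 => if i.val + j.val + 1 = 3 then (1 : L) else 0)).Local v) ⧸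
            Subgroup.centralizer ({γ} : Set ((cmDatum L 3 (Matrix.of fun i j : Fin 3 => if i.val + j.val + 1 = 3 then (1 : L) else 0)).Local v)))]
        [∀ γ : ((cmDatum L 3 (Matrix.of fun i j : Fin 3 => if i.val + j.val + 1 = 3 then (1 : L) else 0)).Local v),
          BorelSpace (((cmDatum L 3 (Matrix.of fun i j : Fin 3 => if i.val + j.val + 1 = 3 then (1 : L) else 0)).Local v) ⧸
            Subgroup.centralizer ({γ} : Set ((cmDatum L 3 (Matrix.of fun i j : Fin 3 => if i.val + j.val + 1 = 3 then (1 : L) else 0)).Local v)))],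
      ∀ (γ : ((cmDatum L 3 (Matrix.of fun i j : Fin 3 => if i.val + j.val + 1 = 3 then (1 : L) else 0)).Local v)),
        (((γ.val : GL (Fin 3) (UnitaryGroup.LocalRing L v)).val - 1) ^ 2 = 0) → γ ≠ 1 →
        ∀ (μ : Measure (((cmDatum L 3 (Matrix.of fun i j : Fin 3 => if i.val + j.val + 1 = 3 then (1 : L) else 0)).Local v) ⧸
            Subgroup.centralizer ({γ} : Set ((cmDatum L 3 (Matrix.of fun i j : Fin 3 => if i.val + j.val + 1 = 3 then (1 : L) else 0)).Local v))))
          [SMulInvariantMeasure ((cmDatum L 3 (Matrix.of fun i j : Fin 3 => if i.val + j.val + 1 = 3 then (1 : L) else 0)).Local v)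
            (((cmDatum L 3 (Matrix.of fun i j : Fin 3 => if i.val + j.val + 1 = 3 then (1 : L) else 0)).Local v) ⧸
              Subgroup.centralizer ({γ} : Set ((cmDatum L 3 (Matrix.of fun i j : Fin 3 => if i.val + j.val + 1 = 3 then (1 : L) else 0)).Local v))) μ]
          [IsFiniteMeasureOnCompacts μ],
        ∀ f : ((cmDatum L 3 (Matrix.of fun i j : Fin 3 => if i.val + j.val + 1 = 3 then (1 : L) else 0)).Local v) → ℂ, IsLocSmooth f →
          Integrable (descConj γ (Subgroup.centralizer ({γ} : Set ((cmDatum L 3 (Matrix.of fun i j : Fin 3 => if i.val + j.val + 1 = 3 then (1 : L) else 0)).Local v)))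
            (fun _ hg => Subgroup.mem_centralizer_singleton_iff.1 hg) f) μ := by
  intro L _ _ _ v w hsub _ _ _ _ γ hsing hγ1 μ _ _ f hf
  exact integrable_descConj_of_measure_preimage_lt_top γ _ _ μ
    (fun _ hC => UnitaryGroup.measure_preimage_descConj_lt_top_of_transvection L v w hsub γ hsing hγ1 μ hC) hf.isLocallyConstant.continuous hf.hasCompactSupport

end CaseHead

end Literature.NumberTheory.Rogawski1990

end
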